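import Summits.HodgeConjecture.HodgeCM.Model.TowerLevel_1

/-! PORT of `HodgeCM/Model/TowerLevel.lean` (HodgeCMPerL run 82) — part 2: continuation of `Summits.HodgeConjecture.HodgeCM.Model.TowerLevel_1` (split at a top-level declaration boundary by port_pkg.py; scope re-opened below; declarations unchanged). -/

-- port_pkg: scope re-opened for this part (file-level context, then the namespace/section stack open at the cut)
noncomputable section
open scoped Matrix
open Matrix Function Set
open NumberField CategoryTheory
open Literature.AlgebraicGeometry.Motives
open Literature.AlgebraicGeometry.ShimuraVarieties
open Literature.AlgebraicGeometry.HodgeTheory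
open Literature.NumberTheory.Automorphic
open Literature.NumberTheory.Automorphic.PicardCM
open Literature.NumberTheory.Transcendental (Arapura2012_Cor_15_4_6)
namespace HodgeCM
namespace Model.TowerLevel
open HodgeCM.Model.LevelTranslate
variable (hHD : exists_isReal_hodgeModel) (hI : hodgePQ_independent_of_hodgeModel)
  (hU : BallQuotientUniformisedDatum) (h₃ : CMAbelianVarietyRealised) (hA : Arapura2012_Cor_15_4_6)
variable {L : CMField} {ι₁ : L →+* ℂ} {V : HermSpace3 L ι₁}
section Translate
/-- **`res ∘ translate g` is the value at the index `g`** (read on `P_{Γ.conj g}`): `res (g • c) = t_1^* (c g)`. -/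
theorem res_translate {Γ : Level V} (hΓ : Γ.BelowConjThree) (g : V.adelicFin) (c : towerLevel hHD hI hU h₃ hA Γ hΓ)
    (ht : TransCond ((1 : ↥(Urat V)) : GL (Fin 3) L) (Γ.conj g hΓ) (Γ.conj (1 * g) hΓ)) :
    res hHD hI hU h₃ hA (translate hHD hI hU h₃ hA hΓ g c) =
      trPull hHD hI hU h₃ hA 1 (Γ.conj g hΓ) (Γ.conj (1 * g) hΓ) ht 1 ((c : Π h, W hHD hI hU h₃ Γ hΓ h) (1 * g)) := by
  rw [res_apply, translate_apply]
  exact trPull_trPull hHD hI hU h₃ hA (mul_one 1).symm _ _ ht 1 _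

/-- **`translate` commutes with the change of level**: for `Γ' ≤ Γ`,
`translate g ∘ restrictLevel = restrictLevel ∘ translate g` (`Γ'.conj g ≤ Γ.conj g`). -/
theorem translate_restrictLevel {Γ Γ' : Level V} (hΓ : Γ.BelowConjThree) (hle : Γ' ≤ Γ) (hΓ' : Γ'.BelowConjThree)
    (g : V.adelicFin) (c : towerLevel hHD hI hU h₃ hA Γ hΓ) :
    translate hHD hI hU h₃ hA hΓ' g (restrictLevel hHD hI hU h₃ hA hle hΓ hΓ' c) =
      restrictLevel hHD hI hU h₃ hA (Level.conj_mono hle g hΓ hΓ') (hΓ.conj g) (hΓ'.conj g)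
        (translate hHD hI hU h₃ hA hΓ g c) := by
  apply Subtype.ext; funext h
  have ht : TransCond ((1 : ↥(Urat V)) : GL (Fin 3) L) ((Γ'.conj g hΓ').conj h (hΓ'.conj g)) (Γ.conj (h * g) hΓ) :=
    (transCond_conj_conj hΓ' g h).one_trans (transCond_conj_of_le hle hΓ hΓ' (h * g))
  rw [translate_apply, restrictLevel_apply, restrictLevel_apply, translate_apply,
    trPull_trPull hHD hI hU h₃ hA (mul_one 1).symm _ _ ht, trPull_trPull hHD hI hU h₃ hA (mul_one 1).symm _ _ ht]

end Translate

end Model.TowerLevel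

end HodgeCM

end
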